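import Summits.Ventures.LatticeQCDFlow.Scoring.OnePlaquetteSU3Enclosures
import HarnessLib

/-!
# The SU(3) one-plaquette law at the S0-C coupling: kernel enclosures of `⟨plaq²⟩₅` and of the plaquette variance

HONEST FRAMING: exact (Metropolis-corrected) sampling algorithms for lattice gauge theory;
figures of merit are autocorrelation/cost numbers at stated couplings and volumes; no
continuum-physics claim.

Venture `LatticeQCDFlow` (cell pub-lqcd), sub-topic `Scoring`; FANOUT row 5 (`s0-sun-a`, S0-C
implementation A — the 'exact 2-d plaquette oracle' column), GEN-16.  NEW WORK of the cell (placement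
rule); extends GEN-6's `Scoring/OnePlaquetteSU3Enclosures.lean` (the plaquette `⟨(1/3) Re tr U⟩_β` at
`β = 4, 5, 6`) by the SECOND MOMENT of the plaquette under the Weyl-torus SU(3) one-plaquette law
`onePlaquetteExpectSU3` at the S0-C point `β = 5.0` (row 5 / row 6, `su3 | 2 | wilson | periodic | 5.0 | 16`),
hence its VARIANCE `v(5) = ⟨plaq²⟩₅ − ⟨plaq⟩₅²`:

* §1 `integral2_plaqSq_weylSU3_mul_pow` — the exact rational moments of the new numerator,
  `∫∫ plaq² |Δ|² (1 + Re tr U)^k = (2π)² (su3Moment(k+2) − 2 su3Moment(k+1) + su3Moment k)/9`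
  (`(Re tr U)² = F² − 2F + 1`, `F = 1 + Re tr U`);
* §2 `su3SqCheck_sound` — soundness of the rational certificate (GEN-6's `ratioCheck` with the
  second-moment partial sums written inline through `psumQ`; no new definition);
* §3 **`onePlaquetteExpectSU3_plaqSq_encl_5`** — `0.197218216291 ≤ ⟨plaq²⟩₅ ≤ 0.197218216292`
  (exact `0.19721821629186527…`; `K = 40` Taylor terms, `decide +kernel`), and
  **`onePlaquetteSU3_variance_encl_5`** — `0.071934473027 ≤ ⟨plaq²⟩₅ − ⟨plaq⟩₅² ≤ 0.071934473030`
  (exact `0.07193447302851990…`), from it and GEN-6's `onePlaquetteExpectSU3_encl_5`.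

Reading (value-free for the cell's tables; nothing of record moves): `v(5)` is the single-plaquette
variance of the INFINITE-VOLUME / open-boundary 2-d SU(3) Wilson law at `β = 5` — the per-plaquette unit
of the ideal-sampler error bar `√(v/(V n))` of a volume-averaged plaquette over `n` independent draws
when plaquettes are independent (open b.c. in axial gauge); the `16²` TORUS covariance corrections are
NOT typed for SU(3) (for U(1)/SU(2) they are `O((I₁/I₀)^{V−3})`, GEN-12/13).  By the calculus companion
`Scoring/OnePlaquetteSU3FreeEnergy.lean` (`d⟨plaq⟩_β/dβ = ⟨plaq²⟩_β − ⟨plaq⟩_β²`) the same number is the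
slope of the SU(3) one-plaquette plaquette at `β = 5`.  Nothing is cited as a fact; no `def`.
-/

namespace Summit.Ventures.LatticeQCDFlow.Scoring

open MeasureTheory intervalIntegral Finset
open scoped Real Nat

/-! ### 1. The rational moments of the second-moment numerator -/

/-- **`∫_0^{2π}∫_0^{2π} plaq² |Δ|² (1 + Re tr U)^k = (2π)² (su3Moment(k+2) − 2 su3Moment(k+1) + su3Moment k)/9`**
(`plaq = Re tr U/3`, `(Re tr U)² = (1 + Re tr U)² − 2(1 + Re tr U) + 1`). -/
theorem integral2_plaqSq_weylSU3_mul_pow (k : ℕ) :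
    (∫ θ₁ in (0 : ℝ)..2 * π, ∫ θ₂ in (0 : ℝ)..2 * π,
        plaqSU3 θ₁ θ₂ * plaqSU3 θ₁ θ₂ * (weylSU3 θ₁ θ₂ * (1 + reTrSU3 θ₁ θ₂) ^ k))
      = (2 * π) ^ 2 * (((su3Moment (k + 2) - 2 * su3Moment (k + 1) + su3Moment k) / 9 : ℚ) : ℝ) := by
  have hpt : ∀ θ₁ θ₂ : ℝ, plaqSU3 θ₁ θ₂ * plaqSU3 θ₁ θ₂ * (weylSU3 θ₁ θ₂ * (1 + reTrSU3 θ₁ θ₂) ^ k)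
      = 1 / 9 * ((weylSU3 θ₁ θ₂ * (1 + reTrSU3 θ₁ θ₂) ^ (k + 2)
          - 2 * (weylSU3 θ₁ θ₂ * (1 + reTrSU3 θ₁ θ₂) ^ (k + 1)))
          + weylSU3 θ₁ θ₂ * (1 + reTrSU3 θ₁ θ₂) ^ k) := by
    intro θ₁ θ₂
    simp only [plaqSU3]
    ring
  simp_rw [hpt]
  rw [integral2_const_mul, integral2_add (by fun_prop) (by fun_prop),
    integral2_sub (by fun_prop) (by fun_prop), integral2_const_mul, integral2_weylSU3_mul_pow,
    integral2_weylSU3_mul_pow, integral2_weylSU3_mul_pow]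
  push_cast
  ring

/-! ### 2. Soundness of the second-moment certificate -/

/-- **Soundness of the SU(3) second-moment checker** (GEN-6's `ratioCheck` with the numerator partial sum
`Σ_{k<K} x^k (su3Moment(k+2) − 2 su3Moment(k+1) + su3Moment k)/(9 k!)` inline, `x = β/3`): a `true`
certificate implies `lo ≤ ⟨plaq²⟩_β ≤ hi`. -/
theorem su3SqCheck_sound {β lo hi : ℚ} {K : ℕ}
    (h : ratioCheck (4 * (β / 3))
      (psumQ (fun k => (β / 3) ^ k / k ! *
        ((su3MomentFast (k + 2) - 2 * su3MomentFast (k + 1) + su3MomentFast k) / 9)) K / 6)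
      (su3Zsum (β / 3) K / 6) lo hi K = true) :
    ((lo : ℚ) : ℝ) ≤ onePlaquetteExpectSU3 ((β : ℚ) : ℝ) (fun θ₁ θ₂ => plaqSU3 θ₁ θ₂ * plaqSU3 θ₁ θ₂) ∧
      onePlaquetteExpectSU3 ((β : ℚ) : ℝ) (fun θ₁ θ₂ => plaqSU3 θ₁ θ₂ * plaqSU3 θ₁ θ₂)
        ≤ ((hi : ℚ) : ℝ) := by
  obtain ⟨hβ, hK, hlo0, htz, htn, hlo, hhi⟩ := ratioCheck_spec h
  have hx : (0 : ℝ) ≤ ((β : ℚ) : ℝ) / 3 := by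
    have : (0 : ℚ) ≤ β := by linarith
    have : (0 : ℝ) ≤ ((β : ℚ) : ℝ) := by exact_mod_cast this
    linarith
  have hK' : 2 * (4 * (((β : ℚ) : ℝ) / 3)) ≤ (K : ℝ) + 1 := by exact_mod_cast hK
  have hw1 : ∀ θ₁ θ₂ : ℝ, |plaqSU3 θ₁ θ₂ * plaqSU3 θ₁ θ₂| ≤ 1 := fun θ₁ θ₂ => by
    rw [abs_mul]
    have h1 := abs_plaqSU3_le θ₁ θ₂
    exact mul_le_one₀ h1 (abs_nonneg _) h1
  have hN := abs_integral2_weight_exp_sub_le (w := fun θ₁ θ₂ => plaqSU3 θ₁ θ₂ * plaqSU3 θ₁ θ₂)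
    (by fun_prop) hw1 (μ := fun k => (su3Moment (k + 2) - 2 * su3Moment (k + 1) + su3Moment k) / 9)
    (fun k => integral2_plaqSq_weylSU3_mul_pow k) hx hK'
  have hZ := abs_integral2_weight_exp_sub_le (w := fun _ _ => (1 : ℝ)) (by fun_prop)
    (fun _ _ => by simp) (μ := su3Moment)
    (fun k => by simpa only [one_mul] using integral2_weylSU3_mul_pow k) hx hK'
  simp only [one_mul] at hZ
  have ez : ((su3Zsum (β / 3) K / 6 : ℚ) : ℝ)
      = (∑ k ∈ range K, (((β : ℚ) : ℝ) / 3) ^ k / (k ! : ℝ) * ((su3Moment k : ℚ) : ℝ)) / 6 := by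
    rw [su3Zsum, psumQ_eq_sum]
    simp_rw [su3MomentFast_eq]
    push_cast
    rfl
  have en : ((psumQ (fun k => (β / 3) ^ k / k ! *
        ((su3MomentFast (k + 2) - 2 * su3MomentFast (k + 1) + su3MomentFast k) / 9)) K / 6 : ℚ) : ℝ)
      = (∑ k ∈ range K, (((β : ℚ) : ℝ) / 3) ^ k / (k ! : ℝ)
          * (((su3Moment (k + 2) - 2 * su3Moment (k + 1) + su3Moment k) / 9 : ℚ) : ℝ)) / 6 := by
    rw [psumQ_eq_sum]
    simp_rw [su3MomentFast_eq]
    push_cast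
    rfl
  have et : ((expTail (4 * (β / 3)) K : ℚ) : ℝ) = 2 * (4 * (((β : ℚ) : ℝ) / 3)) ^ K / (K ! : ℝ) := by
    rw [expTail]
    push_cast
    rfl
  rw [← ez] at hZ
  rw [← en] at hN
  rw [← et] at hZ hN
  unfold onePlaquetteExpectSU3 onePlaquetteZSU3
  exact div_mem_of_abs_sub_le (by positivity) hN hZ (by exact_mod_cast hlo0) (by exact_mod_cast htz)
    (by exact_mod_cast htn) (by exact_mod_cast hlo) (by exact_mod_cast hhi)

/-! ### 3. The enclosures at the S0-C coupling `β = 5` -/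

/-- **SU(3), `β = 5.0`, second moment**: `0.197218216291 ≤ ⟨plaq²⟩₅ ≤ 0.197218216292`
(exact `0.19721821629186527…`). -/
theorem onePlaquetteExpectSU3_plaqSq_encl_5 :
    (197218216291 : ℝ) / 1000000000000
        ≤ onePlaquetteExpectSU3 5 (fun θ₁ θ₂ => plaqSU3 θ₁ θ₂ * plaqSU3 θ₁ θ₂) ∧
      onePlaquetteExpectSU3 5 (fun θ₁ θ₂ => plaqSU3 θ₁ θ₂ * plaqSU3 θ₁ θ₂)
        ≤ (197218216292 : ℝ) / 1000000000000 := by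
  have h := su3SqCheck_sound (β := 5) (lo := 197218216291 / 1000000000000)
    (hi := 197218216292 / 1000000000000) (K := 40) (by decide +kernel)
  push_cast at h
  exact h

/-- **SU(3), `β = 5.0`, plaquette variance**: `0.071934473027 ≤ ⟨plaq²⟩₅ − ⟨plaq⟩₅² ≤ 0.071934473030`
(exact `0.07193447302851990…`; from the second-moment enclosure and GEN-6's plaquette enclosure
`0.353954436705 ≤ ⟨plaq⟩₅ ≤ 0.353954436706`). -/
theorem onePlaquetteSU3_variance_encl_5 :
    (71934473027 : ℝ) / 1000000000000
        ≤ onePlaquetteExpectSU3 5 (fun θ₁ θ₂ => plaqSU3 θ₁ θ₂ * plaqSU3 θ₁ θ₂)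
          - onePlaquetteExpectSU3 5 plaqSU3 ^ 2 ∧
      onePlaquetteExpectSU3 5 (fun θ₁ θ₂ => plaqSU3 θ₁ θ₂ * plaqSU3 θ₁ θ₂)
          - onePlaquetteExpectSU3 5 plaqSU3 ^ 2
        ≤ (71934473030 : ℝ) / 1000000000000 := by
  obtain ⟨h2lo, h2hi⟩ := onePlaquetteExpectSU3_plaqSq_encl_5
  obtain ⟨h1lo, h1hi⟩ := onePlaquetteExpectSU3_encl_5
  have h1nn : 0 ≤ onePlaquetteExpectSU3 5 plaqSU3 := le_trans (by norm_num) h1lo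
  constructor
  · nlinarith [mul_le_mul h1hi h1hi h1nn (by norm_num)]
  · nlinarith [mul_le_mul h1lo h1lo (by norm_num) h1nn]

/-! ### 4. The other two reference couplings `β = 4, 6` (appended 2026-08-23, GEN-16) -/

/-- **SU(3), `β = 4.0`, second moment**: `0.154318229770 ≤ ⟨plaq²⟩₄ ≤ 0.154318229771`
(exact `0.15431822977048337…`; `K = 40`). -/
theorem onePlaquetteExpectSU3_plaqSq_encl_4 :
    (154318229770 : ℝ) / 1000000000000
        ≤ onePlaquetteExpectSU3 4 (fun θ₁ θ₂ => plaqSU3 θ₁ θ₂ * plaqSU3 θ₁ θ₂) ∧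
      onePlaquetteExpectSU3 4 (fun θ₁ θ₂ => plaqSU3 θ₁ θ₂ * plaqSU3 θ₁ θ₂)
        ≤ (154318229771 : ℝ) / 1000000000000 := by
  have h := su3SqCheck_sound (β := 4) (lo := 154318229770 / 1000000000000)
    (hi := 154318229771 / 1000000000000) (K := 40) (by decide +kernel)
  push_cast at h
  exact h

/-- **SU(3), `β = 4.0`, plaquette variance**: `0.076131361053 ≤ ⟨plaq²⟩₄ − ⟨plaq⟩₄² ≤ 0.076131361056`
(exact `0.07613136105410047…`). -/
theorem onePlaquetteSU3_variance_encl_4 :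
    (76131361053 : ℝ) / 1000000000000
        ≤ onePlaquetteExpectSU3 4 (fun θ₁ θ₂ => plaqSU3 θ₁ θ₂ * plaqSU3 θ₁ θ₂)
          - onePlaquetteExpectSU3 4 plaqSU3 ^ 2 ∧
      onePlaquetteExpectSU3 4 (fun θ₁ θ₂ => plaqSU3 θ₁ θ₂ * plaqSU3 θ₁ θ₂)
          - onePlaquetteExpectSU3 4 plaqSU3 ^ 2
        ≤ (76131361056 : ℝ) / 1000000000000 := by
  obtain ⟨h2lo, h2hi⟩ := onePlaquetteExpectSU3_plaqSq_encl_4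
  obtain ⟨h1lo, h1hi⟩ := onePlaquetteExpectSU3_encl_4
  have h1nn : 0 ≤ onePlaquetteExpectSU3 4 plaqSU3 := le_trans (by norm_num) h1lo
  constructor
  · nlinarith [mul_le_mul h1hi h1hi h1nn (by norm_num)]
  · nlinarith [mul_le_mul h1lo h1lo (by norm_num) h1nn]

/-- **SU(3), `β = 6.0`, second moment**: `0.243413554387 ≤ ⟨plaq²⟩₆ ≤ 0.243413554388`
(exact `0.24341355438721123…`; `K = 46`). -/
theorem onePlaquetteExpectSU3_plaqSq_encl_6 :
    (243413554387 : ℝ) / 1000000000000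
        ≤ onePlaquetteExpectSU3 6 (fun θ₁ θ₂ => plaqSU3 θ₁ θ₂ * plaqSU3 θ₁ θ₂) ∧
      onePlaquetteExpectSU3 6 (fun θ₁ θ₂ => plaqSU3 θ₁ θ₂ * plaqSU3 θ₁ θ₂)
        ≤ (243413554388 : ℝ) / 1000000000000 := by
  have h := su3SqCheck_sound (β := 6) (lo := 243413554387 / 1000000000000)
    (hi := 243413554388 / 1000000000000) (K := 46) (by decide +kernel)
  push_cast at h
  exact h

/-- **SU(3), `β = 6.0`, plaquette variance**: `0.064880483375 ≤ ⟨plaq²⟩₆ − ⟨plaq⟩₆² ≤ 0.064880483378`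
(exact `0.06488048337556982…`). -/
theorem onePlaquetteSU3_variance_encl_6 :
    (64880483375 : ℝ) / 1000000000000
        ≤ onePlaquetteExpectSU3 6 (fun θ₁ θ₂ => plaqSU3 θ₁ θ₂ * plaqSU3 θ₁ θ₂)
          - onePlaquetteExpectSU3 6 plaqSU3 ^ 2 ∧
      onePlaquetteExpectSU3 6 (fun θ₁ θ₂ => plaqSU3 θ₁ θ₂ * plaqSU3 θ₁ θ₂)
          - onePlaquetteExpectSU3 6 plaqSU3 ^ 2
        ≤ (64880483378 : ℝ) / 1000000000000 := by
  obtain ⟨h2lo, h2hi⟩ := onePlaquetteExpectSU3_plaqSq_encl_6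
  obtain ⟨h1lo, h1hi⟩ := onePlaquetteExpectSU3_encl_6
  have h1nn : 0 ≤ onePlaquetteExpectSU3 6 plaqSU3 := le_trans (by norm_num) h1lo
  constructor
  · nlinarith [mul_le_mul h1hi h1hi h1nn (by norm_num)]
  · nlinarith [mul_le_mul h1lo h1lo (by norm_num) h1nn]

end Summit.Ventures.LatticeQCDFlow.Scoring
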